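import Literature.Barriers.CriticalPhenomena.PlaquetteWalkSpinRigidity
import HarnessLib

/-!
# Barrier companion (SAWScalingLimit): the sign gauge of the plaquette walk on `ℤ²`

Companion of `Literature.Barriers.CriticalPhenomena.PlaquetteWalkSpinRigidity` and
`PlaquetteWalkWeightRigidityPrinted` (same catalogue entry). Weight rigidity puts every exact vertex
identity of the five-weight plaquette walk (`u₁u₂v ≠ 0`) on one of two rational curves `ybCurve ε t r`,
`ε = ±1`, and `ybCurve 1 t r` is the image of `ybCurve (−1) t r` under the SIGN GAUGE
`𝒢 : (u₁, u₂, v, w₁, w₂) ↦ (−u₁, u₂, −v, w₁, w₂)`. This file proves that `𝒢` is an exact SYMMETRY of the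
technique classes, so that the `ε = +1` curve carries identities exactly when the printed curve does:

* **Parity mechanism.** Label a mid-edge `vert k j` / `slant k j` by the sign `(−1)^{k+j}` (`msign`).
  Inside a face the sides `W, S` carry one sign and `E, N` the other, so an arc flips the sign iff it is
  a corner (`{W,N}`, `{S,E}`) or a straight arc, and keeps it iff it is a co-corner (`{W,S}`, `{N,E}`)
  (`msign_snd_eq`); telescoping along a walk gives `msign z = (∏ arc signs) · msign a`.
* **Structure of a face** (Glazman–Manolescu's Fig. 1, here PROVED from the `YBWalk` axioms — nodup,
  consecutive arcs in different faces): two distinct arcs of a walk in one face have four pairwise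
  distinct ends (`arcs_ends_ne`), hence the same kind (`arcKindOf_eq_of_face`), and no face holds
  three arcs (`no_three_arcs`); so the arcs in a face are `[]`, `[p]` or `[p, q]` with equal kinds
  (`filter_face_cases`).
* **Parity identity** (`prod_arcSign_eq_pow`): `∏ arc signs = (−1)^{n_{u₁} + n_v}` with
  `n_{u₁} = cfgCount · [corner]`, `n_v = cfgCount · [straight]` the exponents of `u₁` and `v` in `weightL`.
* **Gauge symmetry**: `weightL (𝒢W) γ = msign a · msign z · weightL W γ` (`weightL_gauge`),
  `F_{𝒢W}(z) = msign a · msign z · F_W(z)` (`gmObservable_gauge`), and with the gauged coefficients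
  `gaugeCoeff c = (−c_E, −c_N, c_W, c_S)` the vertex functional is a unit multiple of the original
  (`vertexFunctional_gauge`); hence **`ExactPlaquetteVertexRelation.gauge`** and
  **`ExactPlaquetteVertexRelationInt.gauge`**: `c` is an exact vertex relation for `W` (all faces, resp.
  interior faces) ⇒ `gaugeCoeff c` is one for `𝒢W`; named statement **`PlaquetteWalkSignGauge`**
  (`_holds`). Since `𝒢` and `gaugeCoeff` are involutions up to an overall sign of `c`, the converse holds
  too (`ExactPlaquetteVertexRelationInt.gauge_iff`).

Consequence for the lane's classification (venture lane «pcv-sawmu», Tier B, C-B1 «YB completeness»):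
the `ε = +1` rigidity curve `(−u₁, u₂, −v, w₁, w₂)(θ)` carries exactly the identities of the printed
Yang–Baxter family `W(θ)` with coefficients `(1, r, 1, r)` instead of `(1, r, −1, −r)` — as the lane's
tables show numerically (residual ≤ 4·10⁻¹⁶ on four domains); no conjectural component is left in the
five-weight class with `u₁u₂v ≠ 0` beyond the existence question on general domains (C-B2).
Sources: [cite: GlazmanManolescu2019, §1, Fig. 1, eq. (1); §2.1 eq. (2.1)];
[cite: Glazman2015WeightedSAW, Lemma 3.1 (symmetries of the local system)];
[cite: DuminilCopinSmirnov2012, Lemma 1 (shape of the relation)].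
-/

noncomputable section

open Complex

namespace Literature.Barriers.CriticalPhenomena

open Literature.Probability.RandomPlanarGeometry.SAW.YangBaxter
open Literature.Probability.RandomPlanarGeometry.SAW.YangBaxter.MidEdge

namespace PlaquetteWalk

/-! ### Piece 1: parity signs of mid-edges and the sign of an arc -/

/-- The `(x+y)`-parity sign of a mid-edge: `(−1)^{k+j}` for both `vert k j` and `slant k j`.
[folklore] -/
def msign : MidEdge → ℤ
  | .vert k j => ((k + j).negOnePow : ℤ)
  | .slant k j => ((k + j).negOnePow : ℤ)

/-- The sign offset of a side within its face: `W, S ↦ 1`, `E, N ↦ −1`. [folklore] -/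
def sideSign : Side → ℤ
  | .W => 1
  | .S => 1
  | .E => -1
  | .N => -1

/-- `sideSign s * sideSign s = 1`. [folklore] -/
private theorem sideSign_mul_self (s : Side) : sideSign s * sideSign s = 1 := by cases s <;> rfl

/-- The sign of the side `s` of the face `f` is `(−1)^{f.1 + f.2} · sideSign s`. [folklore] -/
private theorem msign_side (f : Face) (s : Side) : msign (f.side s) = ((f.1 + f.2).negOnePow : ℤ) * sideSign s := by
  cases s with
  | W => simp [msign, Face.side, sideSign]
  | S => simp [msign, Face.side, sideSign]
  | E =>
    simp only [msign, Face.side, sideSign, mul_neg, mul_one]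
    rw [show f.1 + 1 + f.2 = f.1 + f.2 + 1 by ring, Int.negOnePow_succ]
    simp
  | N =>
    simp only [msign, Face.side, sideSign, mul_neg, mul_one]
    rw [show f.1 + (f.2 + 1) = f.1 + f.2 + 1 by ring, Int.negOnePow_succ]
    simp

/-- The sign of an arc kind: corner and straight arcs flip the parity sign, co-corner arcs do not.
[folklore] -/
def kindSign : ArcKind → ℤ
  | .corner => -1
  | .straight => -1
  | .coCorner => 1
  | .degen => 1

/-- `kindSign (arcKind s t) = sideSign s * sideSign t`. [folklore] -/
private theorem kindSign_arcKind (s t : Side) : kindSign (arcKind s t) = sideSign s * sideSign t := by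
  cases s <;> cases t <;> rfl

/-- The sign of an arc (`1` if the arc has no face). [folklore] -/
def arcSign (p : MidEdge × MidEdge) : ℤ :=
  match arcKindOf p with
  | some κ => kindSign κ
  | none => 1

/-- **Lemma A.** Across an arc drawn in a face, the parity sign is multiplied by the sign of the
arc's kind. [folklore] -/
private theorem msign_snd_eq {m m' : MidEdge} {f : Face} (h : arcFace (m, m') = some f) :
    msign m' = arcSign (m, m') * msign m := by
  have h' : commonFace m m' = some f := h
  obtain ⟨-, ⟨s, hs⟩, ⟨u, hu⟩⟩ := (commonFace_eq_some_iff m m' f).1 h'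
  subst hs; subst hu
  have hk : arcKindOf (f.side s, f.side u) = some (arcKind s u) := by
    simp [arcKindOf, h, Face.sideOf_side]
  simp only [arcSign, hk, msign_side, kindSign_arcKind]
  linear_combination (-(((f.1 + f.2).negOnePow : ℤ) * sideSign u)) * sideSign_mul_self s

/-- **Telescoping.** Along a list of mid-edges all of whose arcs are drawn in faces, the sign of the
last mid-edge is the sign of the first times the product of the arc signs. [folklore] -/
private theorem msign_getLast : ∀ (l : List MidEdge) (hne : l ≠ []),
    (∀ p ∈ arcsOf l, ∃ f, arcFace p = some f) →
      msign (l.getLast hne) = ((arcsOf l).map arcSign).prod * msign (l.head hne)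
  | [], hne, _ => absurd rfl hne
  | [x], _, _ => by simp
  | x :: y :: l, _, harc => by
    have hxy : ∃ f, arcFace (x, y) = some f := harc (x, y) (by simp [arcsOf_cons_cons])
    obtain ⟨f, hf⟩ := hxy
    have ih := msign_getLast (y :: l) (by simp) (fun p hp => harc p (by simp [arcsOf_cons_cons, hp]))
    rw [List.getLast_cons (by simp), ih, arcsOf_cons_cons, List.map_cons, List.prod_cons,
      List.head_cons, List.head_cons, msign_snd_eq hf]
    ring

/-! ### Piece 2: kinds of arcs in a face; regrouping the arc signs by face -/

/-- An arc drawn in a face joins two distinct sides of it and has a kind. [folklore] -/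
private theorem exists_sides_of_arcFace {p : MidEdge × MidEdge} {f : Face} (h : arcFace p = some f) :
    ∃ s u : Side, p.1 = f.side s ∧ p.2 = f.side u ∧ s ≠ u ∧ arcKindOf p = some (arcKind s u) := by
  obtain ⟨m, m'⟩ := p
  have h' : commonFace m m' = some f := h
  obtain ⟨hne, ⟨s, hs⟩, ⟨u, hu⟩⟩ := (commonFace_eq_some_iff m m' f).1 h'
  subst hs; subst hu
  refine ⟨s, u, rfl, rfl, fun hsu => hne (by rw [hsu]), ?_⟩
  simp [arcKindOf, h, Face.sideOf_side]

/-- The product of the kind signs of the arcs of `A` drawn in `f` equals the product of the arc signs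
over the arcs of `A` whose face is `f`. [folklore] -/
private theorem prod_kindSign_filterMap (f : Face) : ∀ (A : List (MidEdge × MidEdge)),
    ((A.filterMap fun p => if arcFace p = some f then arcKindOf p else none).map kindSign).prod =
      ((A.filter fun p => arcFace p = some f).map arcSign).prod
  | [] => by simp
  | p :: A => by
    have ih := prod_kindSign_filterMap f A
    by_cases hp : arcFace p = some f
    · obtain ⟨s, u, -, -, -, hk⟩ := exists_sides_of_arcFace hp
      rw [List.filterMap_cons, List.filter_cons]
      simp only [hp, if_true, hk, List.map_cons, List.prod_cons, ih, decide_true, arcSign]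
    · rw [List.filterMap_cons, List.filter_cons]
      simp [hp, ih]

/-- Regrouping a product over a list by the fibres of a key. [folklore] -/
private theorem prod_map_eq_prod_fiber {α β M : Type*} [DecidableEq β] [CommMonoid M] (key : α → β) (g : α → M) :
    ∀ (A : List α), (A.map g).prod =
      ∏ b ∈ (A.map key).toFinset, ((A.filter fun x => key x = b).map g).prod
  | [] => by simp
  | x :: A => by
    have ih := prod_map_eq_prod_fiber key g A
    rw [List.map_cons, List.prod_cons, List.map_cons, List.toFinset_cons, ih]
    -- split the product over `insert (key x) S` according to whether `key x ∈ S`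
    set S := (A.map key).toFinset with hS
    have hfib : ∀ b ∈ S, b ≠ key x →
        ((List.filter (fun y => key y = b) (x :: A)).map g).prod = ((A.filter fun y => key y = b).map g).prod := by
      intro b _ hb
      rw [List.filter_cons]
      simp [Ne.symm hb]
    have hx : ((List.filter (fun y => key y = key x) (x :: A)).map g).prod =
        g x * ((A.filter fun y => key y = key x).map g).prod := by
      rw [List.filter_cons]
      simp
    by_cases hmem : key x ∈ S
    · rw [Finset.insert_eq_of_mem hmem]
      rw [← Finset.mul_prod_erase S _ hmem, ← Finset.mul_prod_erase S _ hmem, hx, mul_assoc]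
      congr 1
      congr 1
      exact Finset.prod_congr rfl fun b hb => (hfib b (Finset.mem_of_mem_erase hb) (Finset.ne_of_mem_erase hb)).symm
    · rw [Finset.prod_insert hmem, hx]
      have hempty : ((A.filter fun y => key y = key x).map g).prod = 1 := by
        have : (A.filter fun y => key y = key x) = [] := by
          rw [List.filter_eq_nil_iff]
          intro y hy hyx
          apply hmem
          rw [hS, List.mem_toFinset, List.mem_map]
          exact ⟨y, hy, by simpa using hyx⟩
        rw [this]; simp
      rw [hempty, mul_one]
      congr 1
      exact Finset.prod_congr rfl fun b hb => (hfib b hb (fun h => hmem (h ▸ hb))).symm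

/-! ### Piece 2b: structure of the arcs of a Yang–Baxter walk inside one face -/

section Structure

variable {D : Set Face} {a z : MidEdge}

/-- Two arc kinds drawn on four pairwise distinct sides of a face coincide (the complementary side
pairs `{W,N}/{S,E}`, `{W,S}/{N,E}`, `{W,E}/{S,N}` have equal kinds). [folklore] -/
private theorem arcKind_eq_of_sides_ne : ∀ (s u s' u' : Side), s ≠ u → s' ≠ u' → s ≠ s' → s ≠ u' → u ≠ s' →
    u ≠ u' → arcKind s u = arcKind s' u' := by
  intro s u s' u'
  cases s <;> cases u <;> cases s' <;> cases u' <;> simp [arcKind]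

/-- Four pairwise distinct sides exhaust a face: any fifth side is one of them. [folklore] -/
private theorem side_mem_of_four : ∀ (s u s' u' x : Side), s ≠ u → s ≠ s' → s ≠ u' → u ≠ s' → u ≠ u' →
    s' ≠ u' → (x = s ∨ x = u ∨ x = s' ∨ x = u') := by
  decide

/-- The arcs of a Yang–Baxter walk are pairwise distinct. [folklore] -/
private theorem nodup_arcs (γ : YBWalk D a z) : (arcsOf γ.mids).Nodup := by
  have h : ((arcsOf γ.mids).map Prod.snd).Nodup := by
    rw [arcsOf, List.map_snd_zip (by simp)]
    exact γ.nodup.sublist (List.tail_sublist _)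
  exact h.of_map _

/-- The `k`-th arc of a list. [folklore] -/
private theorem getElem_arcsOf' (l : List MidEdge) {k : ℕ} (hk : k < (arcsOf l).length) :
    (arcsOf l)[k] = (l[k]'(by simp [arcsOf, List.length_zip] at hk; omega),
      l[k + 1]'(by simp [arcsOf, List.length_zip] at hk; omega)) := by
  simp [arcsOf, List.getElem_zip, List.getElem_tail]

/-- **Two distinct arcs of a Yang–Baxter walk in the same face have four pairwise distinct end
mid-edges** (consecutive arcs lie in different faces; non-consecutive ones by self-avoidance).
[cite: GlazmanManolescu2019, §1 and Fig. 1 (walks cross each edge at most once; consecutive arcs in different rhombi)] -/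
theorem arcs_ends_ne (γ : YBWalk D a z) {f : Face} {p q : MidEdge × MidEdge}
    (hp : p ∈ arcsOf γ.mids) (hq : q ∈ arcsOf γ.mids) (hpq : p ≠ q)
    (hpf : arcFace p = some f) (hqf : arcFace q = some f) :
    p.1 ≠ q.1 ∧ p.1 ≠ q.2 ∧ p.2 ≠ q.1 ∧ p.2 ≠ q.2 := by
  obtain ⟨i, hi, rfl⟩ := mem_arcsOf_iff.1 hp
  obtain ⟨j, hj, rfl⟩ := mem_arcsOf_iff.1 hq
  have hnd := γ.nodup
  have hch := γ.isChain
  have hij : i ≠ j := by rintro rfl; exact hpq rfl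
  -- consecutive arcs lie in different faces
  have hcons : ∀ {k : ℕ} (hk : k + 2 < γ.mids.length),
      arcFace (γ.mids[k], γ.mids[k + 1]) ≠ arcFace (γ.mids[k + 1], γ.mids[k + 2]) := by
    intro k hk
    have hlen : k + 1 < (arcsOf γ.mids).length := by simp [arcsOf, List.length_zip]; omega
    have h := List.isChain_iff_getElem.1 hch k hlen
    rwa [getElem_arcsOf', getElem_arcsOf'] at h
  have hne : ∀ {m n : ℕ} (hm : m < γ.mids.length) (hn : n < γ.mids.length), m ≠ n → γ.mids[m] ≠ γ.mids[n] :=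
    fun hm hn hmn h => hmn ((hnd.getElem_inj_iff).1 h)
  rcases Nat.lt_or_gt_of_ne hij with h | h
  · by_cases hji : j = i + 1
    · subst hji
      exact absurd (hpf.trans hqf.symm) (hcons (by omega))
    · exact ⟨hne _ _ (by omega), hne _ _ (by omega), hne _ _ (by omega), hne _ _ (by omega)⟩
  · by_cases hij' : i = j + 1
    · subst hij'
      exact absurd (hqf.trans hpf.symm) (hcons (by omega))
    · exact ⟨hne _ _ (by omega), hne _ _ (by omega), hne _ _ (by omega), hne _ _ (by omega)⟩

/-- Two distinct arcs of a Yang–Baxter walk in the same face have the same kind. [cite: GlazmanManolescu2019, Fig. 1 (the two-arc configurations of a rhombus: two corners or two co-corners)] -/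
theorem arcKindOf_eq_of_face (γ : YBWalk D a z) {f : Face} {p q : MidEdge × MidEdge}
    (hp : p ∈ arcsOf γ.mids) (hq : q ∈ arcsOf γ.mids) (hpq : p ≠ q)
    (hpf : arcFace p = some f) (hqf : arcFace q = some f) : arcKindOf p = arcKindOf q := by
  obtain ⟨h11, h12, h21, h22⟩ := arcs_ends_ne γ hp hq hpq hpf hqf
  obtain ⟨s, u, hs, hu, hsu, hk⟩ := exists_sides_of_arcFace hpf
  obtain ⟨s', u', hs', hu', hsu', hk'⟩ := exists_sides_of_arcFace hqf
  rw [hk, hk']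
  rw [hs, hs'] at h11
  rw [hs, hu'] at h12
  rw [hu, hs'] at h21
  rw [hu, hu'] at h22
  have e1 : s ≠ s' := fun h => h11 (by rw [h])
  have e2 : s ≠ u' := fun h => h12 (by rw [h])
  have e3 : u ≠ s' := fun h => h21 (by rw [h])
  have e4 : u ≠ u' := fun h => h22 (by rw [h])
  rw [arcKind_eq_of_sides_ne s u s' u' hsu hsu' e1 e2 e3 e4]

/-- No face contains three pairwise distinct arcs of a Yang–Baxter walk. [cite: GlazmanManolescu2019, Fig. 1 (a rhombus carries at most two arcs)] -/
theorem no_three_arcs (γ : YBWalk D a z) {f : Face} {p q r : MidEdge × MidEdge}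
    (hp : p ∈ arcsOf γ.mids) (hq : q ∈ arcsOf γ.mids) (hr : r ∈ arcsOf γ.mids)
    (hpq : p ≠ q) (hpr : p ≠ r) (hqr : q ≠ r)
    (hpf : arcFace p = some f) (hqf : arcFace q = some f) (hrf : arcFace r = some f) : False := by
  obtain ⟨h11, h12, h21, h22⟩ := arcs_ends_ne γ hp hq hpq hpf hqf
  obtain ⟨g11, -, g21, -⟩ := arcs_ends_ne γ hp hr hpr hpf hrf
  obtain ⟨k11, -, k21, -⟩ := arcs_ends_ne γ hq hr hqr hqf hrf
  obtain ⟨s, u, hs, hu, hsu, -⟩ := exists_sides_of_arcFace hpf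
  obtain ⟨s', u', hs', hu', hsu', -⟩ := exists_sides_of_arcFace hqf
  obtain ⟨x, y, hx, -, -, -⟩ := exists_sides_of_arcFace hrf
  rw [hs, hs'] at h11
  rw [hs, hu'] at h12
  rw [hu, hs'] at h21
  rw [hu, hu'] at h22
  rw [hs, hx] at g11
  rw [hu, hx] at g21
  rw [hs', hx] at k11
  rw [hu', hx] at k21
  have e1 : s ≠ s' := fun h => h11 (by rw [h])
  have e2 : s ≠ u' := fun h => h12 (by rw [h])
  have e3 : u ≠ s' := fun h => h21 (by rw [h])
  have e4 : u ≠ u' := fun h => h22 (by rw [h])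
  rcases side_mem_of_four s u s' u' x hsu e1 e2 e3 e4 hsu' with h | h | h | h
  · exact g11 (by rw [h])
  · exact g21 (by rw [h])
  · exact k11 (by rw [h])
  · exact k21 (by rw [h])

/-- The arcs of a Yang–Baxter walk in one face: none, one, or two distinct ones of the same kind.
[cite: GlazmanManolescu2019, Fig. 1 (local configurations 1, u₁, u₂, v, w₁, w₂)] -/
theorem filter_face_cases (γ : YBWalk D a z) (f : Face) :
    (arcsOf γ.mids).filter (fun p => arcFace p = some f) = [] ∨
    (∃ p, (arcsOf γ.mids).filter (fun p => arcFace p = some f) = [p] ∧ arcFace p = some f) ∨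
    (∃ p q, (arcsOf γ.mids).filter (fun p => arcFace p = some f) = [p, q] ∧ p ≠ q ∧
      arcFace p = some f ∧ arcFace q = some f ∧ arcKindOf p = arcKindOf q) := by
  have hnd : ((arcsOf γ.mids).filter (fun p => arcFace p = some f)).Nodup := (nodup_arcs γ).filter _
  have hmem : ∀ p ∈ (arcsOf γ.mids).filter (fun p => arcFace p = some f),
      p ∈ arcsOf γ.mids ∧ arcFace p = some f := by
    intro p hp
    rw [List.mem_filter] at hp
    exact ⟨hp.1, by simpa using hp.2⟩
  generalize hAf : (arcsOf γ.mids).filter (fun p => arcFace p = some f) = Af at hnd hmem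
  match Af, hnd, hmem with
  | [], _, _ => exact Or.inl rfl
  | [p], _, hmem => exact Or.inr (Or.inl ⟨p, rfl, (hmem p (by simp)).2⟩)
  | [p, q], hnd, hmem =>
    have hpq : p ≠ q := by
      intro h; subst h; simp at hnd
    obtain ⟨hp, hpf⟩ := hmem p (by simp)
    obtain ⟨hq, hqf⟩ := hmem q (by simp)
    exact Or.inr (Or.inr ⟨p, q, rfl, hpq, hpf, hqf, arcKindOf_eq_of_face γ hp hq hpq hpf hqf⟩)
  | p :: q :: r :: rest, hnd, hmem =>
    exfalso
    have hpq : p ≠ q := by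
      intro h; subst h; exact (List.nodup_cons.1 hnd).1 (by simp)
    have hpr : p ≠ r := by
      intro h; subst h; exact (List.nodup_cons.1 hnd).1 (by simp)
    have hqr : q ≠ r := by
      intro h; subst h; exact (List.nodup_cons.1 (List.nodup_cons.1 hnd).2).1 (by simp)
    obtain ⟨hp, hpf⟩ := hmem p (by simp)
    obtain ⟨hq, hqf⟩ := hmem q (by simp)
    obtain ⟨hr, hrf⟩ := hmem r (by simp)
    exact no_three_arcs γ hp hq hr hpq hpr hqr hpf hqf hrf

end Structure

/-! ### Piece 3: the sign of a face, the parity identity, and the gauge symmetry -/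

section Assembly

variable {D : Set Face} {a z : MidEdge}

/-- The sign of a face's local configuration: `−1` for a single corner or straight arc, `+1` else.
[folklore] -/
def faceSign (ks : List ArcKind) : ℤ := if ks = [.corner] ∨ ks = [.straight] then -1 else 1

/-- `faceSign [κ] = kindSign κ`. [folklore] -/
private theorem faceSign_singleton (κ : ArcKind) : faceSign [κ] = kindSign κ := by
  cases κ <;> simp [faceSign, kindSign]

/-- `faceSign [κ, κ] = 1 = kindSign κ * kindSign κ`. [folklore] -/
private theorem faceSign_pair (κ : ArcKind) : faceSign [κ, κ] = kindSign κ * kindSign κ := by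
  cases κ <;> simp [faceSign, kindSign]

/-- `kindsL` through the filtered arc list. [folklore] -/
private theorem kindsL_eq_filterMap (l : List MidEdge) (f : Face) :
    kindsL l f = ((arcsOf l).filter fun p => arcFace p = some f).filterMap arcKindOf := by
  unfold kindsL
  induction arcsOf l with
  | nil => simp
  | cons p A ih =>
    rw [List.filterMap_cons, List.filter_cons]
    by_cases hp : arcFace p = some f
    · simp only [hp, if_true, decide_true, List.filterMap_cons, ih]
    · simp [hp, ih]

/-- **Per face**: the product of the signs of the arcs of a Yang–Baxter walk drawn in `f` is the sign
of the local configuration of `f`. [folklore] -/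
private theorem prod_arcSign_face (γ : YBWalk D a z) (f : Face) :
    (((arcsOf γ.mids).filter fun p => arcFace p = some f).map arcSign).prod = faceSign (kindsL γ.mids f) := by
  rw [kindsL_eq_filterMap]
  rcases filter_face_cases γ f with h | ⟨p, h, hpf⟩ | ⟨p, q, h, -, hpf, hqf, hk⟩
  · rw [h]; simp [faceSign]
  · obtain ⟨s, u, -, -, -, hkp⟩ := exists_sides_of_arcFace hpf
    rw [h]
    simp [hkp, arcSign, faceSign_singleton]
  · obtain ⟨s, u, -, -, -, hkp⟩ := exists_sides_of_arcFace hpf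
    have hkq : arcKindOf q = some (arcKind s u) := hk ▸ hkp
    rw [h]
    simp [hkp, hkq, arcSign, faceSign_pair]

/-- The sign `(−1)^{n_{u₁} + n_v}` of a list as the product of the face signs. [folklore] -/
private theorem prod_faceSign_eq_pow (l : List MidEdge) : ∀ (L : List Face),
    (L.map fun f => faceSign (kindsL l f)).prod =
      (-1) ^ (L.countP (fun f => kindsL l f = [.corner]) + L.countP (fun f => kindsL l f = [.straight]))
  | [] => by simp
  | f :: L => by
    have ih := prod_faceSign_eq_pow l L
    rw [List.map_cons, List.prod_cons, ih, List.countP_cons, List.countP_cons]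
    by_cases h1 : kindsL l f = [.corner]
    · have h2 : ¬ kindsL l f = [.straight] := by rw [h1]; decide
      simp [faceSign, h1, pow_add, pow_succ]
    · by_cases h2 : kindsL l f = [.straight]
      · simp [faceSign, h2, pow_add, pow_succ]
      · simp [faceSign, h1, h2]

/-- **The parity identity**: for a Yang–Baxter walk, the product of its arc signs is
`(−1)^{n_{u₁} + n_v}` (faces crossed by one corner arc or one straight arc). [cite: GlazmanManolescu2019, §1, Fig. 1 and eq. (1) (the local configurations)] -/
theorem prod_arcSign_eq_pow (γ : YBWalk D a z) :
    ((arcsOf γ.mids).map arcSign).prod =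
      (-1) ^ (cfgCount γ.mids [.corner] + cfgCount γ.mids [.straight]) := by
  set A := arcsOf γ.mids with hA
  have hsome : ∀ p ∈ A, ∃ f, arcFace p = some f := fun p hp => by
    obtain ⟨f, -, hf⟩ := γ.arc_mem p hp; exact ⟨f, hf⟩
  -- regroup the product by face
  rw [prod_map_eq_prod_fiber arcFace arcSign A]
  -- the face list and its finset
  have hT : (facesL γ.mids).toFinset = (A.filterMap arcFace).toFinset := by
    ext f; simp [facesL, List.mem_dedup, hA]
  have hS : (A.map arcFace).toFinset = ((A.filterMap arcFace).toFinset).image some := by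
    ext o
    simp only [List.mem_toFinset, List.mem_map, Finset.mem_image, List.mem_filterMap]
    constructor
    · rintro ⟨p, hp, rfl⟩
      obtain ⟨f, hf⟩ := hsome p hp
      exact ⟨f, ⟨p, hp, hf⟩, hf.symm⟩
    · rintro ⟨f, ⟨p, hp, hf⟩, rfl⟩
      exact ⟨p, hp, hf⟩
  rw [hS, Finset.prod_image (fun x _ y _ h => Option.some_injective _ h)]
  -- per face
  have hface : ∀ f ∈ (A.filterMap arcFace).toFinset,
      ((A.filter fun p => arcFace p = some f).map arcSign).prod = faceSign (kindsL γ.mids f) :=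
    fun f _ => prod_arcSign_face γ f
  have hnd : (facesL γ.mids).Nodup := by unfold facesL; exact List.nodup_dedup _
  rw [Finset.prod_congr rfl hface, ← hT, List.prod_toFinset _ hnd]
  unfold cfgCount
  convert prod_faceSign_eq_pow γ.mids (facesL γ.mids) using 2

/-- `msign m * msign m = 1`. [folklore] -/
private theorem msign_mul_self (m : MidEdge) : msign m * msign m = 1 := by
  cases m <;> simp only [msign, ← Units.val_mul, Int.units_mul_self, Units.val_one]

/-- **The weights side of the gauge**: flipping the signs of the corner weight `u₁` and the straight
weight `v` multiplies the weight of every Yang–Baxter walk by the parity signs of its end mid-edges.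
[cite: GlazmanManolescu2019, §1, eq. (1) (the weight of a walk is the product of the rhombus weights)] -/
theorem weightL_gauge (W : CWeights) (γ : YBWalk D a z) :
    weightL ⟨-W.u₁, W.u₂, -W.v, W.w₁, W.w₂⟩ γ.mids = (msign a * msign z : ℤ) * weightL W γ.mids := by
  have hne : γ.mids ≠ [] := by
    intro h; have := γ.head_eq; rw [h] at this; simp at this
  have hhead : γ.mids.head hne = a := by
    have h := γ.head_eq; rw [List.head?_eq_some_head hne] at h; exact Option.some_injective _ h
  have hlast : γ.mids.getLast hne = z := by
    have h := γ.getLast_eq; rw [List.getLast?_eq_some_getLast hne] at h; exact Option.some_injective _ h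
  have htel := msign_getLast γ.mids hne (fun p hp => by
    obtain ⟨f, -, hf⟩ := γ.arc_mem p hp; exact ⟨f, hf⟩)
  rw [hhead, hlast, prod_arcSign_eq_pow] at htel
  -- `msign z = (−1)^{n₁+n_v} · msign a`, hence `msign a · msign z = (−1)^{n₁+n_v}`
  have hsign : (msign a * msign z : ℤ) = (-1) ^ (cfgCount γ.mids [.corner] + cfgCount γ.mids [.straight]) := by
    rw [htel, ← mul_assoc, mul_comm (msign a), mul_assoc, msign_mul_self, mul_one]
  rw [hsign]
  push_cast
  simp only [weightL, CWeights.mono]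
  rw [neg_pow, neg_pow W.v, pow_add]
  ring

/-- **The observable side of the gauge**: `F_{𝒢W}(z) = msign a · msign z · F_W(z)`. [cite: GlazmanManolescu2019, §2.1, eq. (2.1) (the parafermionic observable)] -/
theorem gmObservable_gauge (W : CWeights) (t : ℂ) (Dl : List Face) (a z : MidEdge) :
    gmObservable ⟨-W.u₁, W.u₂, -W.v, W.w₁, W.w₂⟩ t Dl a z = (msign a * msign z : ℤ) * gmObservable W t Dl a z := by
  unfold gmObservable
  rw [Finset.mul_sum]
  refine Finset.sum_congr rfl fun γ _ => ?_
  rw [weightL_gauge, mul_assoc]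

/-- The gauged coefficient vector `(−c_E, −c_N, c_W, c_S)`. [folklore] -/
def gaugeCoeff (c : Fin 4 → ℂ) : Fin 4 → ℂ := ![-c 0, -c 1, c 2, c 3]

/-- `gaugeCoeff c = 0 ↔ c = 0`. [folklore] -/
private theorem gaugeCoeff_eq_zero_iff (c : Fin 4 → ℂ) : gaugeCoeff c = 0 ↔ c = 0 := by
  constructor
  · intro h
    have h0 := congrFun h 0; have h1 := congrFun h 1; have h2 := congrFun h 2; have h3 := congrFun h 3
    simp [gaugeCoeff] at h0 h1 h2 h3
    funext i; fin_cases i <;> simp [h0, h1, h2, h3]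
  · intro h; subst h; funext i; fin_cases i <;> simp [gaugeCoeff]

/-- **The functional side of the gauge**: with the coefficients `(−c_E, −c_N, c_W, c_S)` the vertex
functional of the gauged weights is a unit multiple of the original one. [cite: DuminilCopinSmirnov2012, Lemma 1 (shape of the relation)] -/
theorem vertexFunctional_gauge (W : CWeights) (t : ℂ) (c : Fin 4 → ℂ) (Dl : List Face) (a : MidEdge)
    (f₀ : Face) :
    vertexFunctional ⟨-W.u₁, W.u₂, -W.v, W.w₁, W.w₂⟩ t (gaugeCoeff c) Dl a f₀ =
      (msign a * ((f₀.1 + f₀.2).negOnePow : ℤ) : ℤ) * vertexFunctional W t c Dl a f₀ := by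
  unfold vertexFunctional
  simp only [Fin.sum_univ_four, gmObservable_gauge]
  have e0 : slotSide f₀ 0 = f₀.side .E := rfl
  have e1 : slotSide f₀ 1 = f₀.side .N := rfl
  have e2 : slotSide f₀ 2 = f₀.side .W := rfl
  have e3 : slotSide f₀ 3 = f₀.side .S := rfl
  have c0 : gaugeCoeff c 0 = -c 0 := rfl
  have c1 : gaugeCoeff c 1 = -c 1 := rfl
  have c2 : gaugeCoeff c 2 = c 2 := rfl
  have c3 : gaugeCoeff c 3 = c 3 := rfl
  rw [e0, e1, e2, e3, c0, c1, c2, c3, msign_side, msign_side, msign_side, msign_side]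
  simp only [sideSign]
  push_cast
  ring

/-- **The sign gauge is a symmetry of the technique class** (all faces): `c` is an exact vertex
relation for `W` iff `(−c_E, −c_N, c_W, c_S)` is one for `𝒢W = (−u₁, u₂, −v, w₁, w₂)`.
[cite: Glazman2015WeightedSAW, Lemma 3.1 (symmetries of the local system)] -/
theorem ExactPlaquetteVertexRelation.gauge {W : CWeights} {t : ℂ} {c : Fin 4 → ℂ}
    (h : ExactPlaquetteVertexRelation W t c) :
    ExactPlaquetteVertexRelation ⟨-W.u₁, W.u₂, -W.v, W.w₁, W.w₂⟩ t (gaugeCoeff c) := by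
  intro Dl a f₀ hf ha
  rw [vertexFunctional_gauge, h Dl a f₀ hf ha, mul_zero]

/-- **The sign gauge is a symmetry of the interior-faces class.**
[cite: Glazman2015WeightedSAW, Lemma 3.1 (symmetries of the local system)] [cite: DuminilCopinSmirnov2012, Lemma 1 (shape of the relation)] -/
theorem ExactPlaquetteVertexRelationInt.gauge {W : CWeights} {t : ℂ} {c : Fin 4 → ℂ}
    (h : ExactPlaquetteVertexRelationInt W t c) :
    ExactPlaquetteVertexRelationInt ⟨-W.u₁, W.u₂, -W.v, W.w₁, W.w₂⟩ t (gaugeCoeff c) := by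
  intro Dl a f₀ hf hint ha
  rw [vertexFunctional_gauge, h Dl a f₀ hf hint ha, mul_zero]

end Assembly

/-! ### The named statement and the converse -/

section Named

/-- **Barrier-companion statement `PlaquetteWalkSignGauge`**: the sign gauge
`(u₁, u₂, v, w₁, w₂; c_E, c_N, c_W, c_S) ↦ (−u₁, u₂, −v, w₁, w₂; −c_E, −c_N, c_W, c_S)` maps exact vertex
relations (interior-faces class) to exact vertex relations. [cite: Glazman2015WeightedSAW, Lemma 3.1 (symmetries of the local system)] [cite: GlazmanManolescu2019, §1, Fig. 1] -/
def _root_.Literature.Barriers.CriticalPhenomena.PlaquetteWalkSignGauge : Prop :=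
  ∀ (W : CWeights) (t : ℂ) (c : Fin 4 → ℂ), ExactPlaquetteVertexRelationInt W t c →
    ExactPlaquetteVertexRelationInt ⟨-W.u₁, W.u₂, -W.v, W.w₁, W.w₂⟩ t (gaugeCoeff c)

/-- Discharge of `PlaquetteWalkSignGauge`. [cite: Glazman2015WeightedSAW, Lemma 3.1] -/
theorem _root_.Literature.Barriers.CriticalPhenomena.PlaquetteWalkSignGauge_holds : PlaquetteWalkSignGauge :=
  fun _ _ _ h => h.gauge

/-- The gauge is an involution on the weights. [cite: Glazman2015WeightedSAW, Lemma 3.1 (symmetries of the local system)] -/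
theorem gauge_gauge (W : CWeights) :
    (⟨-(⟨-W.u₁, W.u₂, -W.v, W.w₁, W.w₂⟩ : CWeights).u₁, (⟨-W.u₁, W.u₂, -W.v, W.w₁, W.w₂⟩ : CWeights).u₂,
      -(⟨-W.u₁, W.u₂, -W.v, W.w₁, W.w₂⟩ : CWeights).v, (⟨-W.u₁, W.u₂, -W.v, W.w₁, W.w₂⟩ : CWeights).w₁,
      (⟨-W.u₁, W.u₂, -W.v, W.w₁, W.w₂⟩ : CWeights).w₂⟩ : CWeights) = W := by
  obtain ⟨u1, u2, v, w1, w2⟩ := W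
  simp

/-- The gauge is an involution on the coefficients. [cite: Glazman2015WeightedSAW, Lemma 3.1 (symmetries of the local system)] -/
theorem gaugeCoeff_gaugeCoeff (c : Fin 4 → ℂ) : gaugeCoeff (gaugeCoeff c) = c := by
  funext i
  fin_cases i <;> simp [gaugeCoeff]

/-- **The sign gauge is an EQUIVALENCE of the interior-faces class.**
[cite: Glazman2015WeightedSAW, Lemma 3.1 (symmetries of the local system)] [cite: DuminilCopinSmirnov2012, Lemma 1 (shape of the relation)] -/
theorem ExactPlaquetteVertexRelationInt.gauge_iff {W : CWeights} {t : ℂ} {c : Fin 4 → ℂ} :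
    ExactPlaquetteVertexRelationInt ⟨-W.u₁, W.u₂, -W.v, W.w₁, W.w₂⟩ t (gaugeCoeff c) ↔
      ExactPlaquetteVertexRelationInt W t c := by
  constructor
  · intro h
    have h' := h.gauge
    rw [gaugeCoeff_gaugeCoeff] at h'
    simpa using h'
  · exact fun h => h.gauge

end Named

end PlaquetteWalk

end Literature.Barriers.CriticalPhenomena

end
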